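import Summits.NavierStokesRegularity.NavierStokesRegularity.Theorems.TypeILiouvilleTypeIliouvilleNoTypeIIEternalEnergyLiouvilleLimitSet
import Summits.NavierStokesRegularity.NavierStokesRegularity.Theorems.TypeILiouvilleTypeIliouvilleNoTypeIIEternalEnergyLiouvilleBackwardVanishing
import HarnessLib

/-!
# Every EEL′-class profile has an α-limit with a vanishing time slice (crux `TypeIliouvilleNoTypeII`,
# stmt-NavierStokesRegularity-0056; rigidity residual EEL′ of the pressure-free eternal split)

Helper file (theorems only).  Combining the compactness of the EEL′ class modulo translations
(`exists_limit_of_translates`, p482393) with backward vanishing in density (`eternal_vanishesBackward`,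
p488411): for a bounded eternal Oseen-mild smooth divergence-free `v` with `A_ess, C, E ≤ I < ∞` on all
parabolic balls,

* `exists_pastTime_small` — for every `k` there is a time `τ ≤ -k` with `∫_{B(0,k+1)} |v(τ)|² ≤ 1/(k+1)`;
* `exists_alphaLimit_zeroSlice` — there are times `τ_j → -∞` such that the time translates
  `v(· + τ_j, ·)` converge at every point to a member `W` of the same class with `W(0, ·) ≡ 0`.

So the α-limit set of every member of the class contains a profile VANISHING IDENTICALLY AT TIME ZERO
(for the residual core of EEL′: the extremal burst is preceded, arbitrarily far in the past and up to
translation limits, by local rest).  WHAT THIS IS NOT: not NS; EEL′ stays OPEN; whether such a `W`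
vanishes for `t < 0` is backward uniqueness, not claimed. [folklore]
-/

noncomputable section

-- the summit and its single problem share the name `NavierStokesRegularity` (D-0017 nested layout)
set_option linter.dupNamespace false

open Set Function Filter Topology MeasureTheory Metric
open scoped NNReal ENNReal

namespace Summit.NavierStokesRegularity.NavierStokesRegularity.Theorems.TypeIliouvilleNoTypeII.TypeIIZoom

open Literature.Analysis Literature.Analysis.FluidPDE

variable {v : ℝ → EuclideanSpace ℝ (Fin 3) → EuclideanSpace ℝ (Fin 3)}

/-- **A continuous function vanishing a.e. on a ball vanishes on the ball.** [folklore] -/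
theorem eq_zero_on_ball_of_ae {F : Type*} [NormedAddCommGroup F]
    {g : EuclideanSpace ℝ (Fin 3) → F} (hg : Continuous g) {R : ℝ}
    (hae : ∀ᵐ y ∂(volume.restrict (ball (0 : EuclideanSpace ℝ (Fin 3)) R)), g y = 0)
    {y₀ : EuclideanSpace ℝ (Fin 3)} (hy₀ : y₀ ∈ ball (0 : EuclideanSpace ℝ (Fin 3)) R) : g y₀ = 0 := by
  by_contra hne
  have hopen : IsOpen ({y | g y ≠ 0} ∩ ball (0 : EuclideanSpace ℝ (Fin 3)) R) :=
    (isOpen_ne_fun hg continuous_const).inter isOpen_ball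
  have hpos : 0 < volume ({y | g y ≠ 0} ∩ ball (0 : EuclideanSpace ℝ (Fin 3)) R) :=
    hopen.measure_pos volume ⟨y₀, hne, hy₀⟩
  have hnull : volume ({y | g y ≠ 0} ∩ ball (0 : EuclideanSpace ℝ (Fin 3)) R) = 0 := by
    have h := hae
    rw [ae_iff, Measure.restrict_apply' measurableSet_ball] at h
    simpa using h
  exact hpos.ne' hnull

/-- **Small past times exist.**  Under `A_ess, E ≤ I ≠ ∞` on all parabolic balls centred on the time
axis, for every `k : ℕ` there is a time `τ < -k` at which `∫_{B(0,k+1)} |v(τ)|² ≤ 1/(k+1)` (backward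
vanishing in density: for large `a` fewer than a quarter of the times in `(-a², 0)` are active, while
`(-a², -a²/2)` is half of them). [folklore] -/
theorem exists_pastTime_small (hv : ContDiff ℝ (⊤ : ℕ∞) (uncurry v)) {I : ℝ≥0∞} (hI : I ≠ ⊤)
    (hA : ∀ a : ℝ, 0 < a → cknAEss a (0 : ℝ × EuclideanSpace ℝ (Fin 3)) v ≤ I)
    (hE : ∀ a : ℝ, 0 < a →
      cknE a (0 : ℝ × EuclideanSpace ℝ (Fin 3)) (fun s y => fderiv ℝ (v s) y) ≤ I) (k : ℕ) :
    ∃ τ : ℝ, τ < -(k : ℝ) ∧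
      ∫⁻ y in ball (0 : EuclideanSpace ℝ (Fin 3)) ((k : ℝ) + 1), ‖v τ y‖ₑ ^ 2 ≤
        ENNReal.ofReal (1 / ((k : ℝ) + 1)) := by
  have hk1 : (0 : ℝ) < (k : ℝ) + 1 := by positivity
  have hlim := eternal_vanishesBackward hv hI hA hE hk1 (one_div_pos.2 hk1)
  have hev1 : ∀ᶠ a : ℝ in atTop,
      volume {τ : ℝ | τ ∈ Set.Ioo (-(a ^ 2)) 0 ∧ ENNReal.ofReal (1 / ((k : ℝ) + 1)) <
          ∫⁻ y in ball (0 : EuclideanSpace ℝ (Fin 3)) ((k : ℝ) + 1), ‖v τ y‖ₑ ^ 2} /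
        ENNReal.ofReal (a ^ 2) < 1 / 4 :=
    (tendsto_order.1 hlim).2 _ (by norm_num)
  have hev2 : ∀ᶠ a : ℝ in atTop, 2 * ((k : ℝ) + 1) ≤ a ^ 2 := by
    refine (eventually_ge_atTop (2 * ((k : ℝ) + 1))).mono fun a ha => ?_
    have h1 : (1 : ℝ) ≤ a := by linarith [(show (0 : ℝ) ≤ k from Nat.cast_nonneg k)]
    nlinarith
  obtain ⟨a, ha1, ha2⟩ := (hev1.and hev2).exists
  set B : Set ℝ := {τ : ℝ | τ ∈ Set.Ioo (-(a ^ 2)) 0 ∧ ENNReal.ofReal (1 / ((k : ℝ) + 1)) <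
      ∫⁻ y in ball (0 : EuclideanSpace ℝ (Fin 3)) ((k : ℝ) + 1), ‖v τ y‖ₑ ^ 2} with hB
  have ha2pos : 0 < a ^ 2 := by linarith
  have hBlt : volume B < 1 / 4 * ENNReal.ofReal (a ^ 2) := by
    rwa [ENNReal.div_lt_iff (Or.inl (ENNReal.ofReal_pos.2 ha2pos).ne') (Or.inl ENNReal.ofReal_ne_top)]
      at ha1
  -- the early half `J = (-a², -a²/2)` is not contained in the bad set
  set J : Set ℝ := Set.Ioo (-(a ^ 2)) (-(a ^ 2 / 2)) with hJ
  have hJvol : volume J = ENNReal.ofReal (a ^ 2 / 2) := by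
    rw [hJ, Real.volume_Ioo]; congr 1; ring
  have hnot : ¬ J ⊆ B := by
    intro hsub
    have h1 : ENNReal.ofReal (a ^ 2 / 2) ≤ volume B := hJvol ▸ measure_mono hsub
    have h2 : ENNReal.ofReal (a ^ 2 / 2) < 1 / 4 * ENNReal.ofReal (a ^ 2) := h1.trans_lt hBlt
    rw [show (1 : ℝ≥0∞) / 4 = ENNReal.ofReal (1 / 4) by
        rw [ENNReal.ofReal_div_of_pos (by norm_num : (0:ℝ) < 4)]; simp,
      ← ENNReal.ofReal_mul (by norm_num)] at h2
    have h3 := (ENNReal.ofReal_lt_ofReal_iff (by positivity)).1 h2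
    linarith
  obtain ⟨τ, hτJ, hτB⟩ := Set.not_subset.1 hnot
  refine ⟨τ, ?_, ?_⟩
  · have h := hτJ.2
    linarith
  · have hτI : τ ∈ Set.Ioo (-(a ^ 2)) 0 := ⟨hτJ.1, by linarith [hτJ.2]⟩
    by_contra hlt
    exact hτB ⟨hτI, not_le.1 hlt⟩

/-- **An α-limit with a vanishing time slice.**  Every bounded eternal Oseen-mild smooth
divergence-free field with `A_ess, C, E ≤ I ≠ ∞` on all parabolic balls has a sequence of times
`τ_j → -∞` along which the time translates converge at every point to a member `W` of the same class
(same `N`, `I`) with `W(0, ·) ≡ 0`. [folklore] -/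
theorem exists_alphaLimit_zeroSlice (hv : ContDiff ℝ (⊤ : ℕ∞) (uncurry v))
    (hdiv : ∀ t, VectorCalculus.IsDivFree (v t))
    (hmild : ∀ s t : ℝ, s < t → ∀ x, v t x = heatFlow (v s) (t - s) x - oseenDuhamel 1 s v v t x)
    {N : ℝ} (hbd : ∀ (t : ℝ) (x : EuclideanSpace ℝ (Fin 3)), ‖v t x‖ ≤ N) {I : ℝ≥0∞} (hI : I ≠ ⊤)
    (hball : ∀ r : ℝ, 0 < r → ∀ z : ℝ × EuclideanSpace ℝ (Fin 3),
      cknAEss r z v ≤ I ∧ cknC r z v ≤ I ∧ cknE r z (fun s y => fderiv ℝ (v s) y) ≤ I) :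
    ∃ (τ : ℕ → ℝ) (W : ℝ → EuclideanSpace ℝ (Fin 3) → EuclideanSpace ℝ (Fin 3)),
      Tendsto τ atTop atBot ∧
      ContDiff ℝ (⊤ : ℕ∞) (uncurry W) ∧ (∀ t, VectorCalculus.IsDivFree (W t)) ∧
      (∀ s t : ℝ, s < t → ∀ x, W t x = heatFlow (W s) (t - s) x - oseenDuhamel 1 s W W t x) ∧
      (∀ t x, ‖W t x‖ ≤ N) ∧
      (∀ r : ℝ, 0 < r → ∀ z : ℝ × EuclideanSpace ℝ (Fin 3),
        cknAEss r z W ≤ I ∧ cknC r z W ≤ I ∧ cknE r z (fun s y => fderiv ℝ (W s) y) ≤ I) ∧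
      (∀ t x, Tendsto (fun j => v (t + τ j) x) atTop (𝓝 (W t x))) ∧
      ∀ y, W 0 y = 0 := by
  -- small past times
  have hsmall := fun k : ℕ => exists_pastTime_small hv hI (fun a ha => (hball a ha 0).1)
    (fun a ha => (hball a ha 0).2.2) k
  choose σ hσlt hσsmall using hsmall
  -- a convergent subsequence of the time translates
  obtain ⟨φ, hφ, W, hW, hWdiv, hWmild, hWbd, hWI, hWlim, -⟩ :=
    exists_limit_of_translates hv hdiv hmild hbd hball σ (fun _ => 0)
  have hWlim' : ∀ t x, Tendsto (fun j => v (t + σ (φ j)) x) atTop (𝓝 (W t x)) := fun t x => by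
    simpa using hWlim t x
  refine ⟨fun j => σ (φ j), W, ?_, hW, hWdiv, hWmild, hWbd, hWI, hWlim', ?_⟩
  · -- `σ (φ j) < -φ j ≤ -j`
    refine tendsto_atBot.2 fun b => ?_
    refine (eventually_ge_atTop (Nat.ceil (-b))).mono fun j hj => ?_
    have h1 : (σ (φ j)) < -((φ j : ℕ) : ℝ) := hσlt (φ j)
    have h2 : (j : ℝ) ≤ ((φ j : ℕ) : ℝ) := by exact_mod_cast hφ.id_le j
    have h3 : -b ≤ (j : ℝ) := (Nat.le_ceil (-b)).trans (by exact_mod_cast hj)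
    linarith
  · -- the zero slice: Fatou on every ball `B(0, R)`
    intro y
    set R : ℝ := ‖y‖ + 1 with hR
    have hyR : y ∈ ball (0 : EuclideanSpace ℝ (Fin 3)) R := by
      rw [mem_ball, dist_zero_right, hR]; linarith
    have hWc : Continuous (W 0) := hW.continuous.comp (Continuous.prodMk_right (0 : ℝ))
    refine eq_zero_on_ball_of_ae hWc ?_ hyR
    -- `∫_{B_R} |W(0)|² ≤ liminf ∫_{B_R} |v(σ (φ j))|² = 0`
    have hmeas : ∀ j, AEMeasurable (fun x => ‖v (0 + σ (φ j)) x‖ₑ ^ 2)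
        (volume.restrict (ball (0 : EuclideanSpace ℝ (Fin 3)) R)) := fun j =>
      ((hv.continuous.comp (Continuous.prodMk_right _)).measurable.enorm.pow_const 2).aemeasurable
    have hFatou := lintegral_liminf_le' (μ := volume.restrict (ball (0 : EuclideanSpace ℝ (Fin 3)) R))
      (u := atTop) hmeas
    have hpt : ∀ x, liminf (fun j => ‖v (0 + σ (φ j)) x‖ₑ ^ 2) atTop = ‖W 0 x‖ₑ ^ 2 := fun x =>
      (ENNReal.Tendsto.pow (hWlim' 0 x).enorm).liminf_eq
    rw [lintegral_congr fun x => hpt x] at hFatou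
    -- the right-hand liminf vanishes
    have hbound : ∀ᶠ j in atTop, ∫⁻ x in ball (0 : EuclideanSpace ℝ (Fin 3)) R, ‖v (0 + σ (φ j)) x‖ₑ ^ 2 ≤
        ENNReal.ofReal (1 / (((φ j : ℕ) : ℝ) + 1)) := by
      refine (eventually_ge_atTop (Nat.ceil R)).mono fun j hj => ?_
      have hRj : R ≤ ((φ j : ℕ) : ℝ) + 1 := by
        have h1 : R ≤ (j : ℝ) := (Nat.le_ceil R).trans (by exact_mod_cast hj)
        have h2 : (j : ℝ) ≤ ((φ j : ℕ) : ℝ) := by exact_mod_cast hφ.id_le j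
        linarith
      calc ∫⁻ x in ball (0 : EuclideanSpace ℝ (Fin 3)) R, ‖v (0 + σ (φ j)) x‖ₑ ^ 2
          ≤ ∫⁻ x in ball (0 : EuclideanSpace ℝ (Fin 3)) (((φ j : ℕ) : ℝ) + 1), ‖v (σ (φ j)) x‖ₑ ^ 2 := by
            rw [zero_add]; exact lintegral_mono_set (ball_subset_ball hRj)
        _ ≤ ENNReal.ofReal (1 / (((φ j : ℕ) : ℝ) + 1)) := hσsmall (φ j)
    have hzero : Tendsto (fun j => ENNReal.ofReal (1 / (((φ j : ℕ) : ℝ) + 1))) atTop (𝓝 0) := by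
      rw [← ENNReal.ofReal_zero]
      exact ENNReal.tendsto_ofReal (tendsto_one_div_add_atTop_nhds_zero_nat.comp hφ.tendsto_atTop)
    have hlim0 : liminf (fun j => ∫⁻ x in ball (0 : EuclideanSpace ℝ (Fin 3)) R,
        ‖v (0 + σ (φ j)) x‖ₑ ^ 2) atTop ≤ 0 := by
      calc liminf (fun j => ∫⁻ x in ball (0 : EuclideanSpace ℝ (Fin 3)) R, ‖v (0 + σ (φ j)) x‖ₑ ^ 2) atTop
          ≤ liminf (fun j => ENNReal.ofReal (1 / (((φ j : ℕ) : ℝ) + 1))) atTop := liminf_le_liminf hbound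
        _ = 0 := hzero.liminf_eq
    have hint0 : ∫⁻ x in ball (0 : EuclideanSpace ℝ (Fin 3)) R, ‖W 0 x‖ₑ ^ 2 = 0 :=
      le_antisymm (hFatou.trans hlim0) bot_le
    have hWm : AEMeasurable (fun x => ‖W 0 x‖ₑ ^ 2)
        (volume.restrict (ball (0 : EuclideanSpace ℝ (Fin 3)) R)) :=
      (hWc.measurable.enorm.pow_const 2).aemeasurable
    have hae := (lintegral_eq_zero_iff' hWm).1 hint0
    filter_upwards [hae] with x hx
    have h2 : ‖W 0 x‖ₑ = 0 := by simpa using hx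
    exact enorm_eq_zero.1 h2

end Summit.NavierStokesRegularity.NavierStokesRegularity.Theorems.TypeIliouvilleNoTypeII.TypeIIZoom

end
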